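import Literature.MathematicalPhysics.QuantumLattice.DWaveSourceNNNHopping
import Literature.MathematicalPhysics.QuantumLattice.FinDimSpectrumProofs
import HarnessLib

/-!
# PINNING-FIELD rows: energy and observable cells for the `d`-wave pair-sourced `t–t'` Hubbard tori
# `A_L = H^{tt'}_L(1,tp,U) − μN − h(Δ_d + Δ_d†)` — rational slots, finite torus, uniform in `L`

HONEST FRAMING: first certified bounds on pairing observables; not a superconductivity verdict; every
number certified (two lineages + referee) or labelled float. A response AT FIXED `h > 0` is
symmetry-allowed and says nothing about spontaneous order (`h → 0` after `L → ∞`; barrier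
`SourcedOrderWithoutGroundStateLRO` is PLACED, not crossed).

WHAT THIS FILE IS (cell hubbard-cq, D-0082 (c) / LADDER row PC-a "pinning-field response", seat
hubbard-cq-obsth-1 "pinning-field K5 menu nodes"). The K5 observable menu of the hubbard-obs cell
(pair windows `P_d(r)`, `F₂`, one-point `Φ₀`, docc, controls; typed cells `Rows/DopedTLCorr.lean`) speaks
about torus-LIMIT ground states of the PARTICLE-NUMBER CONSERVING model given a certified energy window.
With the pinning field the particle number is not conserved (only `S^z` and fermion parity are), the
model is grand canonical (`μ`), no thermodynamic-limit energy functional is typed, and the energy at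
field `h` is itself the primary datum (Hellmann–Feynman chords `e₀(h ± δh)` give the response
`m_d(h)`). Hence the cells of this file are FINITE-TORUS cells with the per-site energy as a rational
slot, in two strengths, each also in the UNIFORM-IN-`L` shape (`∀ L ≥ L₀` with `q ∣ L`):

* §1 ENERGY cells `SourcedTorusEnergyLowerRow / UpperRow L tp U μ h e` (`e·L² ≤ E₀(A_L)`, resp. `≥`;
  `E₀` = ground-state energy on the full Fock space, `Matrix.groundEnergy`) and the uniform
  `SourcedEnergyLowerRow / UpperRow tp U μ h q L₀ e`; the lower slot is what a gauge-broken window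
  certificate proves (`dWaveSourceTorus_groundEnergy_ge_of_window_certificate[_d4]`, tp = 0, via
  `SourcedTorusEnergyLowerRow.of_tp0`), the upper slot what a trial state proves (`…UpperRow.of_trial`).
* §2 OBSERVABLE cells in EIGENVECTOR-BELOW-CAP form `SourcedTorusCorrLowerRow / UpperRow L tp U μ h u r Λ'
  hInj' S Xw`: for every unit `ψ` with `S^z ψ = M ψ` (any `M`) and `A_L ψ = E ψ`, `E/L² ≤ u`, the
  space-group-averaged expectation `Re ω̄_ψ(Γ(ι_{Λ',L}) Xw)` (`orbitState (spaceGroupUnitary S) ψ`,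
  labels `S ⊆ D₄`; `S = {1}` = translation average) is `≥ r` (resp. `≤ r`) — VERBATIM the conclusion
  shape of the tree soundness theorem `dWaveSourceTorusTT'_re_orbitState_ge_of_local_certificate_ineq_of_energy_le`
  (hook `SourcedTorusCorrLowerRow.of_torus_certificate`, companion file `SourcedTorusRowsHook.lean`); and in GROUND-STATE form
  `SourcedTorusCorrLowerRowGS / UpperRowGS L tp U μ h r …` (every unit ground-state vector with
  `S^z ψ = M ψ`, NO energy hypothesis) — the shape a Hellmann–Feynman bracket delivers and the shape a
  below-cap row takes once the cap is a certified upper energy row (`…LowerRow.gs_of_energyUpperRow`).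
* (companion file `SourcedTorusRowsHook.lean`) §2b the certificate HOOK and §3 the DICTIONARY for the
  one-point pair word: `Re ω̄_ψ(Γ(Φ₀ + Φ₀ᴴ)) = Re ⟨ψ, (Δ_d + Δ_dᴴ) ψ⟩ / L²` — the quantity bracketed by
  sourced-energy chords (`DWaveSourceProofs`: `(h' − h)·⟨O⟩_h ≤ E(h) − E(h')`) IS the one-point cell's
  observable.

Solver-free edges: upper cells from lower cells of `−Xw`; monotonicity in every slot; `q`/`L₀`
weakening; below-cap + energy ceiling ⇒ ground-state form; lower ≤ upper energy slots (non-vacuity of the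
energy cells). NOTHING IS ASSERTED: every bound-valued statement is a `def … : Prop` or takes cells as
hypotheses; cells are instantiated only under `Certificates/` from certificate files. No `sorry`, no
named fact. Not here: chords/tangents in `h` (concavity of `h ↦ E₀(A_L(h))`; seat obsth-2), the
Hellmann–Feynman bracket itself (seat obsth-3), torus-limit (`L → ∞`) cells, the window-level
(pull-back) soundness theorem for the sourced `t–t'` model.

References: T. Koma, H. Tasaki, J. Stat. Phys. 76 (1994) 745, §1; H. Xu et al., Science 384 (2024)
eadh7691, eq. (1) (pairing pinning fields); J. Wang et al., PRX 14 (2024) 031006, §III; X. Han,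
arXiv:2006.06002, §3; D. J. Scalapino, Phys. Rep. 250 (1995) 329, §2.
-/

noncomputable section

namespace Summit.Ventures.CertifiedManyBodySolver

open Literature.MathematicalPhysics.QuantumLattice
open Matrix HubbardWave0 Literature.Probability.LatticeModels Finset
open Literature.MathematicalPhysics.QuantumManyBody.StateRelaxation
open scoped BigOperators ComplexOrder

/-- (Local to this file, as in the tree's torus soundness files `HubbardNNNHoppingCorrelatorCertificate`,
`DWaveSourceWindowCertificate[D4]`, `DWaveSourceNNNHopping`: torus sites are compared through the linear
order, so that the cells below match the soundness theorem
`dWaveSourceTorusTT'_re_orbitState_ge_of_local_certificate_ineq` and the `fermionEmbed_toTorusEmb_*`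
dictionary LITERALLY. A consumer elaborated under another `DecidableEq (FermionTorus 2 L)` instance
bridges with `convert … using _` (the instances agree by `Subsingleton.elim`), as
`dWaveSourceTorus_groundEnergy_ge_of_window_certificate_eventually` does.) -/
local instance (priority := high) instDecidableEqFermionTorusSourcedRows {L : ℕ} :
    DecidableEq (FermionTorus 2 L) :=
  LinearOrder.toDecidableEq

/-! ## §1  Energy cells of the pair-sourced torus -/

section Energy

/-- §1 (ENERGY FLOOR, one torus). `e · L² ≤ E₀(A_L)`, `A_L = dWaveSourceTorusTT' L tp U μ h`
(`= H^{tt'}_L(1,tp,U) − μN − h(Δ_d + Δ_d†)`), `E₀` the ground-state energy on the FULL Fock space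
(all particle numbers, all `S^z`). Slot `e` = energy PER SITE. -/
def SourcedTorusEnergyLowerRow (L : ℕ) [NeZero L] (tp U μ h : ℝ) (e : ℚ) : Prop :=
  ((e : ℚ) : ℝ) * (L : ℝ) ^ 2 ≤ (dWaveSourceTorusTT' L tp U μ h).groundEnergy

/-- §1 (ENERGY CEILING, one torus). `E₀(A_L) ≤ e · L²`. -/
def SourcedTorusEnergyUpperRow (L : ℕ) [NeZero L] (tp U μ h : ℝ) (e : ℚ) : Prop :=
  (dWaveSourceTorusTT' L tp U μ h).groundEnergy ≤ ((e : ℚ) : ℝ) * (L : ℝ) ^ 2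

/-- §1 (ENERGY FLOOR, uniform). `e · L² ≤ E₀(A_L)` for every side `L ≥ L₀` with `q ∣ L` (`q = 1`: all
sides — the shape of a translation-invariant window certificate, which holds on every torus into which
its window fits). -/
def SourcedEnergyLowerRow (tp U μ h : ℝ) (q L₀ : ℕ) (e : ℚ) : Prop :=
  ∀ (L : ℕ) [NeZero L], L₀ ≤ L → q ∣ L → SourcedTorusEnergyLowerRow L tp U μ h e

/-- §1 (ENERGY CEILING, uniform). `E₀(A_L) ≤ e · L²` for every side `L ≥ L₀` with `q ∣ L` (trial states
tiling the torus by `q × q` blocks give `q ∣ L`). -/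
def SourcedEnergyUpperRow (tp U μ h : ℝ) (q L₀ : ℕ) (e : ℚ) : Prop :=
  ∀ (L : ℕ) [NeZero L], L₀ ≤ L → q ∣ L → SourcedTorusEnergyUpperRow L tp U μ h e

variable {L : ℕ} [NeZero L] {tp U μ h : ℝ} {e e' : ℚ} {q q' L₀ L₀' : ℕ}

/-- Monotonicity of the floor slot. -/
theorem SourcedTorusEnergyLowerRow.mono (hrow : SourcedTorusEnergyLowerRow L tp U μ h e) (he : e' ≤ e) :
    SourcedTorusEnergyLowerRow L tp U μ h e' := by
  unfold SourcedTorusEnergyLowerRow at hrow ⊢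
  have h' : ((e' : ℚ) : ℝ) * (L : ℝ) ^ 2 ≤ ((e : ℚ) : ℝ) * (L : ℝ) ^ 2 :=
    mul_le_mul_of_nonneg_right (by exact_mod_cast he) (by positivity)
  exact h'.trans hrow

/-- Monotonicity of the ceiling slot. -/
theorem SourcedTorusEnergyUpperRow.mono (hrow : SourcedTorusEnergyUpperRow L tp U μ h e) (he : e ≤ e') :
    SourcedTorusEnergyUpperRow L tp U μ h e' := by
  unfold SourcedTorusEnergyUpperRow at hrow ⊢
  have h' : ((e : ℚ) : ℝ) * (L : ℝ) ^ 2 ≤ ((e' : ℚ) : ℝ) * (L : ℝ) ^ 2 :=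
    mul_le_mul_of_nonneg_right (by exact_mod_cast he) (by positivity)
  exact hrow.trans h'

/-- NON-VACUITY ⇒ CONSISTENCY: a floor slot never exceeds a ceiling slot on the same torus. (A certificate
pair with `e' < e` is an EVENT — one of the two files is wrong — not a bracket.) -/
theorem SourcedTorusEnergyLowerRow.le_of_upperRow (hlo : SourcedTorusEnergyLowerRow L tp U μ h e)
    (hhi : SourcedTorusEnergyUpperRow L tp U μ h e') : e ≤ e' := by
  unfold SourcedTorusEnergyLowerRow at hlo
  unfold SourcedTorusEnergyUpperRow at hhi
  have hL : (0 : ℝ) < (L : ℝ) ^ 2 := by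
    have : (0 : ℝ) < (L : ℝ) := by exact_mod_cast Nat.pos_of_ne_zero (NeZero.ne L)
    positivity
  have h := hlo.trans hhi
  exact_mod_cast le_of_mul_le_mul_right h hL

/-- The ceiling cell from a TRIAL STATE: any unit vector `φ` with `Re ⟨φ, A_L φ⟩ ≤ e · L²` (variational
principle, `Matrix.groundEnergy_le_rayleigh_holds`). -/
theorem SourcedTorusEnergyUpperRow.of_trial {φ : Fock (Orb (FermionTorus 2 L))} (hφ : star φ ⬝ᵥ φ = 1)
    (hle : (star φ ⬝ᵥ dWaveSourceTorusTT' L tp U μ h *ᵥ φ).re ≤ ((e : ℚ) : ℝ) * (L : ℝ) ^ 2) :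
    SourcedTorusEnergyUpperRow L tp U μ h e :=
  (Matrix.groundEnergy_le_rayleigh_holds (dWaveSourceTorusTT'_isHermitian L tp U μ h) φ hφ).trans hle

/-- The floor cell at `tp = 0` from a bound on the tree's `dWaveSourceTorus` (the conclusion shape of
`dWaveSourceTorus_groundEnergy_ge_of_window_certificate[_d4]`: `(c − Σ‖aₖ‖)·L² ≤ E₀`, with `e ≤ c − Σ‖aₖ‖`). -/
theorem SourcedTorusEnergyLowerRow.of_tp0 {c : ℝ} (hc : ((e : ℚ) : ℝ) ≤ c)
    (hE : c * (L : ℝ) ^ 2 ≤ (dWaveSourceTorus L U μ h).groundEnergy) :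
    SourcedTorusEnergyLowerRow L 0 U μ h e := by
  unfold SourcedTorusEnergyLowerRow
  rw [dWaveSourceTorusTT'_zero_tp]
  exact (mul_le_mul_of_nonneg_right hc (by positivity)).trans hE

/-- Weakening of the uniform floor: smaller slot, later onset, finer side progression. -/
theorem SourcedEnergyLowerRow.mono (hrow : SourcedEnergyLowerRow tp U μ h q L₀ e) (he : e' ≤ e)
    (hL : L₀ ≤ L₀') (hq : q ∣ q') : SourcedEnergyLowerRow tp U μ h q' L₀' e' :=
  fun L _ hL' hq' => (hrow L (hL.trans hL') (hq.trans hq')).mono he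

/-- Weakening of the uniform ceiling. -/
theorem SourcedEnergyUpperRow.mono (hrow : SourcedEnergyUpperRow tp U μ h q L₀ e) (he : e ≤ e')
    (hL : L₀ ≤ L₀') (hq : q ∣ q') : SourcedEnergyUpperRow tp U μ h q' L₀' e' :=
  fun L _ hL' hq' => (hrow L (hL.trans hL') (hq.trans hq')).mono he

/-- The uniform floor from an EVENTUAL bound of the `∃ L₀, ∀ L ≥ L₀` shape (e.g.
`dWaveSourceTorus_groundEnergy_ge_of_window_certificate_eventually` at `tp = 0`). -/
theorem SourcedEnergyLowerRow.of_forall (hrow : ∀ (L : ℕ) [NeZero L], L₀ ≤ L →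
      ((e : ℚ) : ℝ) * (L : ℝ) ^ 2 ≤ (dWaveSourceTorusTT' L tp U μ h).groundEnergy) :
    SourcedEnergyLowerRow tp U μ h q L₀ e :=
  fun L _ hL _ => hrow L hL

end Energy

/-! ## §2  Observable cells: eigenvector-below-cap form and ground-state form -/

section Corr

/-- §2 (LOWER, eigenvector-below-cap, one torus). For every real `M`, every unit `ψ` in the `S^z = M`
eigenspace (`fockSpinZSector M`, all particle numbers) with `A_L ψ = E ψ` and `E / L² ≤ u`:
`r ≤ Re ω̄_ψ(Γ(ι_{Λ',L}) Xw)`, `ω̄_ψ = orbitState (spaceGroupUnitary S) ψ` the vector state averaged over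
the translations and the point-group labels `S ⊆ D₄` (soundness requires `χ_{B₁g} = 1` on `S`; `S = {1}`
is the plain translation average), `Γ(ι_{Λ',L}) = fermionEmbed (PolySite.toTorusEmb L hInj')` the
pull-back of the window observable `Xw ∈ 𝔄_{Λ'}` into the torus. Verbatim conclusion shape of
`dWaveSourceTorusTT'_re_orbitState_ge_of_local_certificate_ineq_of_energy_le`. -/
def SourcedTorusCorrLowerRow (L : ℕ) [NeZero L] (tp U μ h : ℝ) (u r : ℚ) (Λ' : Finset (Site 2))
    (hInj' : Set.InjOn (Torus.proj (d := 2) L) ↑Λ') (S : Finset (DihedralGroup 4)) (Xw : FermionOp Λ') :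
    Prop :=
  ∀ (M E : ℝ) (ψ : Fock (Orb (FermionTorus 2 L))), ψ ∈ fockSpinZSector (Λ := FermionTorus 2 L) M →
    star ψ ⬝ᵥ ψ = 1 → dWaveSourceTorusTT' L tp U μ h *ᵥ ψ = (E : ℂ) • ψ →
    E / (L : ℝ) ^ 2 ≤ ((u : ℚ) : ℝ) →
    ((r : ℚ) : ℝ) ≤ (orbitState (spaceGroupUnitary S) ψ (fermionEmbed (PolySite.toTorusEmb L hInj') Xw)).re

/-- §2 (UPPER, eigenvector-below-cap, one torus): same class, conclusion `Re ω̄_ψ(Γ Xw) ≤ r`. -/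
def SourcedTorusCorrUpperRow (L : ℕ) [NeZero L] (tp U μ h : ℝ) (u r : ℚ) (Λ' : Finset (Site 2))
    (hInj' : Set.InjOn (Torus.proj (d := 2) L) ↑Λ') (S : Finset (DihedralGroup 4)) (Xw : FermionOp Λ') :
    Prop :=
  ∀ (M E : ℝ) (ψ : Fock (Orb (FermionTorus 2 L))), ψ ∈ fockSpinZSector (Λ := FermionTorus 2 L) M →
    star ψ ⬝ᵥ ψ = 1 → dWaveSourceTorusTT' L tp U μ h *ᵥ ψ = (E : ℂ) • ψ →
    E / (L : ℝ) ^ 2 ≤ ((u : ℚ) : ℝ) →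
    (orbitState (spaceGroupUnitary S) ψ (fermionEmbed (PolySite.toTorusEmb L hInj') Xw)).re ≤ ((r : ℚ) : ℝ)

/-- §2 (LOWER, GROUND-STATE form, one torus). For every real `M` and every unit ground-state vector
`ψ` of `A_L` (`Matrix.IsGroundStateVector`: `A_L ψ = E₀ ψ`) in the `S^z = M` eigenspace:
`r ≤ Re ω̄_ψ(Γ(ι_{Λ',L}) Xw)`. No energy hypothesis. -/
def SourcedTorusCorrLowerRowGS (L : ℕ) [NeZero L] (tp U μ h : ℝ) (r : ℚ) (Λ' : Finset (Site 2))
    (hInj' : Set.InjOn (Torus.proj (d := 2) L) ↑Λ') (S : Finset (DihedralGroup 4)) (Xw : FermionOp Λ') :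
    Prop :=
  ∀ (M : ℝ) (ψ : Fock (Orb (FermionTorus 2 L))), ψ ∈ fockSpinZSector (Λ := FermionTorus 2 L) M →
    star ψ ⬝ᵥ ψ = 1 → (dWaveSourceTorusTT' L tp U μ h).IsGroundStateVector ψ →
    ((r : ℚ) : ℝ) ≤ (orbitState (spaceGroupUnitary S) ψ (fermionEmbed (PolySite.toTorusEmb L hInj') Xw)).re

/-- §2 (UPPER, GROUND-STATE form, one torus). -/
def SourcedTorusCorrUpperRowGS (L : ℕ) [NeZero L] (tp U μ h : ℝ) (r : ℚ) (Λ' : Finset (Site 2))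
    (hInj' : Set.InjOn (Torus.proj (d := 2) L) ↑Λ') (S : Finset (DihedralGroup 4)) (Xw : FermionOp Λ') :
    Prop :=
  ∀ (M : ℝ) (ψ : Fock (Orb (FermionTorus 2 L))), ψ ∈ fockSpinZSector (Λ := FermionTorus 2 L) M →
    star ψ ⬝ᵥ ψ = 1 → (dWaveSourceTorusTT' L tp U μ h).IsGroundStateVector ψ →
    (orbitState (spaceGroupUnitary S) ψ (fermionEmbed (PolySite.toTorusEmb L hInj') Xw)).re ≤ ((r : ℚ) : ℝ)

/-- §2 (LOWER, eigenvector-below-cap, UNIFORM): the one-torus cell on every side `L ≥ L₀` with `q ∣ L`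
into which the window fits (`hInj'` — inhabited as soon as `L` exceeds the diameter of `Λ'`). -/
def SourcedCorrLowerRow (tp U μ h : ℝ) (q L₀ : ℕ) (u r : ℚ) (Λ' : Finset (Site 2))
    (S : Finset (DihedralGroup 4)) (Xw : FermionOp Λ') : Prop :=
  ∀ (L : ℕ) [NeZero L] (hInj' : Set.InjOn (Torus.proj (d := 2) L) ↑Λ'), L₀ ≤ L → q ∣ L →
    SourcedTorusCorrLowerRow L tp U μ h u r Λ' hInj' S Xw

/-- §2 (UPPER, eigenvector-below-cap, UNIFORM). -/
def SourcedCorrUpperRow (tp U μ h : ℝ) (q L₀ : ℕ) (u r : ℚ) (Λ' : Finset (Site 2))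
    (S : Finset (DihedralGroup 4)) (Xw : FermionOp Λ') : Prop :=
  ∀ (L : ℕ) [NeZero L] (hInj' : Set.InjOn (Torus.proj (d := 2) L) ↑Λ'), L₀ ≤ L → q ∣ L →
    SourcedTorusCorrUpperRow L tp U μ h u r Λ' hInj' S Xw

/-- §2 (LOWER, ground-state form, UNIFORM). -/
def SourcedCorrLowerRowGS (tp U μ h : ℝ) (q L₀ : ℕ) (r : ℚ) (Λ' : Finset (Site 2))
    (S : Finset (DihedralGroup 4)) (Xw : FermionOp Λ') : Prop :=
  ∀ (L : ℕ) [NeZero L] (hInj' : Set.InjOn (Torus.proj (d := 2) L) ↑Λ'), L₀ ≤ L → q ∣ L →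
    SourcedTorusCorrLowerRowGS L tp U μ h r Λ' hInj' S Xw

/-- §2 (UPPER, ground-state form, UNIFORM). -/
def SourcedCorrUpperRowGS (tp U μ h : ℝ) (q L₀ : ℕ) (r : ℚ) (Λ' : Finset (Site 2))
    (S : Finset (DihedralGroup 4)) (Xw : FermionOp Λ') : Prop :=
  ∀ (L : ℕ) [NeZero L] (hInj' : Set.InjOn (Torus.proj (d := 2) L) ↑Λ'), L₀ ≤ L → q ∣ L →
    SourcedTorusCorrUpperRowGS L tp U μ h r Λ' hInj' S Xw

variable {L : ℕ} [NeZero L] {tp U μ h : ℝ} {u u' r r' e : ℚ} {Λ' : Finset (Site 2)}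
  {hInj' : Set.InjOn (Torus.proj (d := 2) L) ↑Λ'} {S : Finset (DihedralGroup 4)} {Xw : FermionOp Λ'}
  {q q' L₀ L₀' : ℕ}

/-- UPPER cells from LOWER cells on the negated objective (linearity of `Γ` and of the orbit state). -/
theorem SourcedTorusCorrUpperRow.of_lower_neg (hrow : SourcedTorusCorrLowerRow L tp U μ h u (-r) Λ' hInj' S (-Xw)) :
    SourcedTorusCorrUpperRow L tp U μ h u r Λ' hInj' S Xw := by
  intro M E ψ hψ h1 hE hu
  have h := hrow M E ψ hψ h1 hE hu
  rw [fermionEmbed_neg, map_neg, Complex.neg_re, Rat.cast_neg, neg_le_neg_iff] at h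
  exact h

/-- UPPER ground-state cells from LOWER ground-state cells on the negated objective. -/
theorem SourcedTorusCorrUpperRowGS.of_lower_neg (hrow : SourcedTorusCorrLowerRowGS L tp U μ h (-r) Λ' hInj' S (-Xw)) :
    SourcedTorusCorrUpperRowGS L tp U μ h r Λ' hInj' S Xw := by
  intro M ψ hψ h1 hgs
  have h := hrow M ψ hψ h1 hgs
  rw [fermionEmbed_neg, map_neg, Complex.neg_re, Rat.cast_neg, neg_le_neg_iff] at h
  exact h

/-- Monotonicity of the below-cap LOWER cell: a smaller cap restricts the class, a smaller bound slot
weakens the conclusion. -/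
theorem SourcedTorusCorrLowerRow.mono (hrow : SourcedTorusCorrLowerRow L tp U μ h u r Λ' hInj' S Xw)
    (hu : u' ≤ u) (hr : r' ≤ r) : SourcedTorusCorrLowerRow L tp U μ h u' r' Λ' hInj' S Xw := by
  intro M E ψ hψ h1 hE hu'
  have hcap : E / (L : ℝ) ^ 2 ≤ ((u : ℚ) : ℝ) := hu'.trans (by exact_mod_cast hu)
  exact (show ((r' : ℚ) : ℝ) ≤ ((r : ℚ) : ℝ) by exact_mod_cast hr).trans (hrow M E ψ hψ h1 hE hcap)

/-- Monotonicity of the below-cap UPPER cell. -/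
theorem SourcedTorusCorrUpperRow.mono (hrow : SourcedTorusCorrUpperRow L tp U μ h u r Λ' hInj' S Xw)
    (hu : u' ≤ u) (hr : r ≤ r') : SourcedTorusCorrUpperRow L tp U μ h u' r' Λ' hInj' S Xw := by
  intro M E ψ hψ h1 hE hu'
  have hcap : E / (L : ℝ) ^ 2 ≤ ((u : ℚ) : ℝ) := hu'.trans (by exact_mod_cast hu)
  exact (hrow M E ψ hψ h1 hE hcap).trans (by exact_mod_cast hr)

/-- Monotonicity of the ground-state LOWER cell. -/
theorem SourcedTorusCorrLowerRowGS.mono (hrow : SourcedTorusCorrLowerRowGS L tp U μ h r Λ' hInj' S Xw)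
    (hr : r' ≤ r) : SourcedTorusCorrLowerRowGS L tp U μ h r' Λ' hInj' S Xw :=
  fun M ψ hψ h1 hgs => (show ((r' : ℚ) : ℝ) ≤ ((r : ℚ) : ℝ) by exact_mod_cast hr).trans (hrow M ψ hψ h1 hgs)

/-- Monotonicity of the ground-state UPPER cell. -/
theorem SourcedTorusCorrUpperRowGS.mono (hrow : SourcedTorusCorrUpperRowGS L tp U μ h r Λ' hInj' S Xw)
    (hr : r ≤ r') : SourcedTorusCorrUpperRowGS L tp U μ h r' Λ' hInj' S Xw :=
  fun M ψ hψ h1 hgs => (hrow M ψ hψ h1 hgs).trans (by exact_mod_cast hr)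

/-- **Below-cap cell + energy ceiling ⇒ ground-state cell.** If the cap `u` of a below-cap LOWER cell is
a certified energy CEILING of the same torus (`E₀(A_L) ≤ u · L²`), every ground-state vector is feasible
and the bound holds for all of them (Wang et al. 2024 §III: the ground state satisfies `⟨E_up − H⟩ ≥ 0`). -/
theorem SourcedTorusCorrLowerRow.gs_of_energyUpperRow (hrow : SourcedTorusCorrLowerRow L tp U μ h u r Λ' hInj' S Xw)
    (hE : SourcedTorusEnergyUpperRow L tp U μ h u) : SourcedTorusCorrLowerRowGS L tp U μ h r Λ' hInj' S Xw := by
  intro M ψ hψ h1 hgs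
  have hL : (0 : ℝ) < (L : ℝ) ^ 2 := by
    have : (0 : ℝ) < (L : ℝ) := by exact_mod_cast Nat.pos_of_ne_zero (NeZero.ne L)
    positivity
  have hcap : (dWaveSourceTorusTT' L tp U μ h).groundEnergy / (L : ℝ) ^ 2 ≤ ((u : ℚ) : ℝ) :=
    (div_le_iff₀ hL).2 hE
  exact hrow M _ ψ hψ h1 hgs.2 hcap

/-- The UPPER twin of `SourcedTorusCorrLowerRow.gs_of_energyUpperRow`. -/
theorem SourcedTorusCorrUpperRow.gs_of_energyUpperRow (hrow : SourcedTorusCorrUpperRow L tp U μ h u r Λ' hInj' S Xw)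
    (hE : SourcedTorusEnergyUpperRow L tp U μ h u) : SourcedTorusCorrUpperRowGS L tp U μ h r Λ' hInj' S Xw := by
  intro M ψ hψ h1 hgs
  have hL : (0 : ℝ) < (L : ℝ) ^ 2 := by
    have : (0 : ℝ) < (L : ℝ) := by exact_mod_cast Nat.pos_of_ne_zero (NeZero.ne L)
    positivity
  have hcap : (dWaveSourceTorusTT' L tp U μ h).groundEnergy / (L : ℝ) ^ 2 ≤ ((u : ℚ) : ℝ) :=
    (div_le_iff₀ hL).2 hE
  exact hrow M _ ψ hψ h1 hgs.2 hcap

/-- Weakening of the uniform below-cap LOWER cell (slots, onset, side progression). -/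
theorem SourcedCorrLowerRow.mono (hrow : SourcedCorrLowerRow tp U μ h q L₀ u r Λ' S Xw) (hu : u' ≤ u)
    (hr : r' ≤ r) (hL : L₀ ≤ L₀') (hq : q ∣ q') : SourcedCorrLowerRow tp U μ h q' L₀' u' r' Λ' S Xw :=
  fun L _ hInj hL' hq' => (hrow L hInj (hL.trans hL') (hq.trans hq')).mono hu hr

/-- Weakening of the uniform below-cap UPPER cell. -/
theorem SourcedCorrUpperRow.mono (hrow : SourcedCorrUpperRow tp U μ h q L₀ u r Λ' S Xw) (hu : u' ≤ u)
    (hr : r ≤ r') (hL : L₀ ≤ L₀') (hq : q ∣ q') : SourcedCorrUpperRow tp U μ h q' L₀' u' r' Λ' S Xw :=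
  fun L _ hInj hL' hq' => (hrow L hInj (hL.trans hL') (hq.trans hq')).mono hu hr

/-- **Uniform below-cap cell + uniform energy ceiling ⇒ uniform ground-state cell** (on the common sides:
the later onset and the ceiling's side progression, the below-cap cell being weakened to it). -/
theorem SourcedCorrLowerRow.gs_of_energyUpperRow (hrow : SourcedCorrLowerRow tp U μ h q L₀ u r Λ' S Xw)
    (hE : SourcedEnergyUpperRow tp U μ h q' L₀' u) (hq : q ∣ q') :
    SourcedCorrLowerRowGS tp U μ h q' (max L₀ L₀') r Λ' S Xw :=
  fun L _ hInj hL hq' => (hrow L hInj ((le_max_left _ _).trans hL) (hq.trans hq')).gs_of_energyUpperRow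
    (hE L ((le_max_right _ _).trans hL) hq')

/-- The UPPER twin of `SourcedCorrLowerRow.gs_of_energyUpperRow`. -/
theorem SourcedCorrUpperRow.gs_of_energyUpperRow (hrow : SourcedCorrUpperRow tp U μ h q L₀ u r Λ' S Xw)
    (hE : SourcedEnergyUpperRow tp U μ h q' L₀' u) (hq : q ∣ q') :
    SourcedCorrUpperRowGS tp U μ h q' (max L₀ L₀') r Λ' S Xw :=
  fun L _ hInj hL hq' => (hrow L hInj ((le_max_left _ _).trans hL) (hq.trans hq')).gs_of_energyUpperRow
    (hE L ((le_max_right _ _).trans hL) hq')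

end Corr

end Summit.Ventures.CertifiedManyBodySolver

end
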